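import Summits.HodgeConjecture.Statement
import Summits.HodgeConjecture.HodgeConjecture.Cruxes.SectorComplement.StrategyCensus13684
import Literature.StrongHypotheses.HodgeConjecture
import HarnessLib
import HarnessLib.Audit.TribunalTags

/-!
# Summit `HodgeConjecture` — bridges of the Strong-Hypothesis Library (D-0034, skeleton)

Summit-side BRIDGE file for the registry `Literature/StrongHypotheses/HodgeConjecture.lean` (census
there). The three registered hypotheses of this summit are SUMMIT-SIDE closed `Prop`s of the built
Cruxes file `Summits/HodgeConjecture/HodgeConjecture/Cruxes/SectorComplement/StrategyCensus13684.lean`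
(namespace `Summit.HodgeConjecture.HodgeConjecture.Cruxes.SectorComplement.StrategyCensus.NikulinTwinTransport`,
abbreviated `SC`; NOT a Theses file — its decls are typed with the real-carrier Literature vocabulary and
are not route cruxes), so they are tagged HERE with `attribute [strong_hypothesis "HodgeConjecture.HodgeConjecture"]`
(Literature cannot import them), and each gets exactly ONE bridge tagged
`@[summit_bridge "HodgeConjecture.HodgeConjecture"]` concluding the ROOT problem decl `_root_.HodgeConjecture`
(`Summits/HodgeConjecture/HodgeConjecture/Statement.lean`).

* LANDED (1, `↔`, equivalent criterion): `middleAll_iff_hodgeConjecture` = `SC.hodgeConjecture_iff_middleAll.symm`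
  (Brosnan–Fang–Nie–Pearlstein 2009 Lemma 48, in tree over `middleDimensionReduction_holds` and
  `nonempty_hodgeModel_holds`).
* PRINTED (2, named facts per CONVENTIONS §4, to be discharged by a literature-prover as
  `theorem <name>_holds` in `Summits/HodgeConjecture/HodgeConjecture/Theorems/StrongHypotheses<H>Bridge.lean`):
  `MotivatedSummitImpliesHodgeConjecture` (André 1996 §0.3 / §2.1) and `QbarSummitImpliesHodgeConjecture`
  (Voisin 2007 Prop. 1.2). Both implications exist in the tree CONDITIONALLY on an undischarged named
  fact (`SC.hodgeConjecture_of_motivatedSummit` over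
  `Literature.AlgebraicGeometry.HodgeTheory.Andre1996_motivatedClasses_le_algebraicClasses_of_standardConjectureB`;
  `SC.hodgeConjecture_of_qbarSummit` over
  `Literature.AlgebraicGeometry.HodgeTheory.voisin2007_hodgeConjecture_weaklyAbsolute_of_qbar`), which is
  why they are PRINTED and not LANDED bridges: discharging the bridge = discharging that fact.

No new mathematics is proved here; no `sorry`, no axiom; no Theses decl is tagged or asserted.
-/

/-! ## Summit-side conjecture `def`s, tagged in place (no restatement) -/

attribute [strong_hypothesis "HodgeConjecture.HodgeConjecture"]
  Summit.HodgeConjecture.HodgeConjecture.Cruxes.SectorComplement.StrategyCensus.NikulinTwinTransport.MiddleAll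
  Summit.HodgeConjecture.HodgeConjecture.Cruxes.SectorComplement.StrategyCensus.NikulinTwinTransport.MotivatedSummit
  Summit.HodgeConjecture.HodgeConjecture.Cruxes.SectorComplement.StrategyCensus.NikulinTwinTransport.QbarSummit

namespace Summit.HodgeConjecture.StrongHypotheses

open Summit.HodgeConjecture.HodgeConjecture.Cruxes.SectorComplement.StrategyCensus.NikulinTwinTransport

/-! ## Equivalent criterion (landed) -/

/-- **Middle-degree reduction ⇔ summit** (landed): the Hodge conjecture holds for all smooth projective
complex varieties iff every rational middle-degree Hodge class on every EVEN-dimensional smooth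
projective complex variety is algebraic (`MiddleAll`). Below the middle one multiplies by projective
spaces, above the middle one cuts by linear sections and uses weak Lefschetz; in tree
`SC.hodgeConjecture_iff_middleAll` over `middleDimensionReduction_holds` and `nonempty_hodgeModel_holds`.
[cite: BrosnanFangNiePearlstein2009, Lemma 48] -/
@[summit_bridge "HodgeConjecture.HodgeConjecture"]
theorem middleAll_iff_hodgeConjecture : MiddleAll ↔ _root_.HodgeConjecture :=
  hodgeConjecture_iff_middleAll.symm

/-! ## Equivalent-in-print packages (printed bridges) -/

/-- **André's motivated package ⟹ HC** — named fact: if Grothendieck's standard conjecture of Lefschetz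
type `B(Z)` holds for every smooth projective complex `Z` (the Lefschetz involution `*_L` of every
polarisation is an algebraic correspondence, `LefschetzBAll`) AND every rational `(p,p)`-class on every
smooth projective complex variety is an André motivated class (`HodgeIsMotivatedAll`), then the Hodge
conjecture holds. Printed: André 1996, §0.3 ("cette notion se réduit à celle de cycle algébrique si pour
tout objet de `𝒱` l'involution `*_L` est donnée par une correspondance algébrique") and the remark after
Déf. 1, §2.1 (`A_mot(X) = A(X)` under `B`); then a motivated Hodge class is algebraic. PROOF PLAN for the
discharge `theorem MotivatedSummitImpliesHodgeConjecture_holds`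
(`Summits/HodgeConjecture/HodgeConjecture/Theorems/StrongHypothesesMotivatedSummitBridge.lean`):
`SC.hodgeConjecture_of_motivatedSummit hA` with
`hA := Andre1996_motivatedClasses_le_algebraicClasses_of_standardConjectureB_holds_of hcup`
(`Literature/AlgebraicGeometry/HodgeTheory/MotivatedClassesAssembly`), so the whole content is
`hcup : Voisin2003_cupProduct_algebraicClasses` — the cup product of classes supported in codimension
`a` and `b` is supported in codimension `a + b` on a smooth projective complex variety (Voisin II
Prop. 9.20 with Lemmas 9.18, 9.22; Fulton §19.1, moving the supports), for the tree's Alexander–Whitney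
`cupProduct` on `complexBetti`. [cite: Andre1996Motifs, §0.3 (pp. 7–8) and §2.1 remark following Déf. 1 (p. 14)] -/
@[summit_bridge "HodgeConjecture.HodgeConjecture"]
def MotivatedSummitImpliesHodgeConjecture : Prop :=
  MotivatedSummit → _root_.HodgeConjecture

/-- **Voisin's `ℚ̄`-package ⟹ HC** — named fact: if the Hodge conjecture holds for every complex base
change `X₀ ×_{ℚ̄,σ} ℂ` of a smooth projective `ℚ̄`-variety AND every rational `(p,p)`-class on every smooth
projective complex variety is weakly absolute Hodge (`QbarSummit`), then the Hodge conjecture holds.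
Printed: Voisin, *Hodge loci and absolute Hodge classes*, Compos. Math. 143 (2007), Prop. 1.2 (weakly
absolute reading, Def. 2.1, Rem. 1.4): "Assume the Hodge conjecture is known for varieties `X_ℚ̄` defined
over `ℚ̄` and weakly absolute Hodge classes `α` on them. Then the Hodge conjecture is true for weakly
absolute Hodge classes" (spread `X` over a `ℚ̄`-variety `S`, the Hodge locus of a weakly absolute class
is defined over `ℚ̄`, specialise to a `ℚ̄`-point and come back by the global invariant cycle theorem
and a polarisation argument). PROOF PLAN for the discharge `theorem QbarSummitImpliesHodgeConjecture_holds`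
(`Summits/HodgeConjecture/HodgeConjecture/Theorems/StrongHypothesesQbarSummitBridge.lean`):
`SC.hodgeConjecture_of_qbarSummit hV` with `hV : voisin2007_hodgeConjecture_weaklyAbsolute_of_qbar`
(`Literature/AlgebraicGeometry/HodgeTheory/HodgeConjectureQbarVoisin`), whose companion
`HodgeConjectureQbarVoisinProofs` already proves the flat/open-immersion transport lemmas and isolates
the remaining input (Deligne's global invariant cycle theorem on the real carriers + algebraicity of
the Hodge locus of a weakly absolute class over `ℚ̄`). [cite: Voisin2007HodgeLoci, Prop. 1.2, Rem. 1.4 and Def. 2.1] -/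
@[summit_bridge "HodgeConjecture.HodgeConjecture"]
def QbarSummitImpliesHodgeConjecture : Prop :=
  QbarSummit → _root_.HodgeConjecture

end Summit.HodgeConjecture.StrongHypotheses
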